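import Mathlib.NumberTheory.Real.Irrational
import Mathlib.Analysis.SpecialFunctions.Pow.Real
import Mathlib.Analysis.SpecialFunctions.Sqrt
import Mathlib.Data.Set.Card
import Mathlib.Data.Nat.Totient
import Mathlib.Data.Rat.Lemmas
import Literature.NumberTheory.Transcendental.PeriodsWave0
import Literature.NumberTheory.Multiplicative.SigmaTotientOrder
import HarnessLib

/-!
# The number of irrational odd zeta values is `≫ √(s / log s)` (Lai–Yu 2020; Lai 2025)

Topic `Literature/NumberTheory/Irrationality/LaiYu2020`. Typed, cited statements (named facts, no proofs) read
on the page from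

* L. Lai, P. Yu, *A note on the number of irrational odd zeta values*, Compositio Math. **156** (2020)
  1699–1717 = arXiv:1911.08458 [LaiYu2020] (held: `paper:arxiv-1911.08458`, arXiv text), §1 Theorem 1.1
  (main theorem), §2 Definition 2.1 and Proposition 2.2, §6 Proposition 6.1;
* L. Lai, *A note on the number of irrational odd zeta values, II*, arXiv:2501.05321 (2025) [Lai2025]
  (held: `paper:arxiv-2501.05321`, arXiv text), §1 Theorem 1.1 — the record constant `1.284579` (§6: the
  parameters `M = 1, J = 1, δ₁ = 0` of its Theorem 5.2 "rediscover the result in [LY2020]" with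
  `C₀ = 1.192507…`).

These sharpen, for large `s`, the COUNT of irrational numbers among `ζ(3), ζ(5), …, ζ(s)`:
Ball–Rivoal 2001 give `(1 − ε) log s/(1 + log 2)` of them, even linearly independent (tree, PROVED:
`Literature.NumberTheory.Transcendental.ball_rivoal_holds`); Fischler–Sprang–Zudilin 2019 give
`2^{(1−ε) log s / log log s}` irrational ones (tree, named fact
`Literature.NumberTheory.Irrationality.FischlerSprangZudilin2019.manyOddZetaValuesIrrational`); Lai–Yu 2020:
"**Theorem 1.1.** For any small `ε > 0`, for all odd integer `s` sufficiently large with respect to `ε`, there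
are at least `(c₀ − ε) s^{1/2} / log^{1/2} s` many irrational numbers among `{ζ(3), ζ(5), ζ(7), ⋯, ζ(s)}`,
where the constant `c₀ = √( (4ζ(2)ζ(3)/ζ(6)) (1 − log((√(4e²+1) − 1)/2)) ) = 1.192507…`." ("The work is
based on the previous work of Fischler, Sprang and Zudilin [FSZ2019], improves the lower bound
`2^{(1−ε) log s / log log s}` therein. The main new ingredient is an optimal design for the zeros of the
auxiliary rational functions, which relates to the inverse of Euler totient function", abstract); Lai 2025:
"**Theorem 1.1.** For any sufficiently large positive integer `s`, we have
`#{odd i ∈ [3, s] | ζ(i) ∉ ℚ} ≥ 1.284579 · √(s / log s)`" ("The proof combines the elimination technique of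
Fischler-Sprang-Zudilin (2019) with the `Φₙ` factor method of Zudilin (2001)", abstract). For comparison (LINEAR
INDEPENDENCE rather than irrationality): Fischler 2026, `dim ≥ 0.21 √(s / log s)` (tree, named fact
`Literature.NumberTheory.Irrationality.Fischler2026.oddZetaSpan_finrank_ge_sqrt`).

## Contents
* `r₀ = (√(4e²+1) − 1)/2 ≈ 2.26388` — the optimal Ball–Rivoal length parameter of [LaiYu2020, §5]; `c₀` — the
  constant of Theorem 1.1 (closed form, as printed);
* NAMED FACT `theorem11` — [LaiYu2020, Thm 1.1];
* `denominatorSet B = Ψ_B = {b ∈ ℕ | φ(b) ≤ B}` and `zeroSet B = 𝓕_B = {a/b | b ∈ Ψ_B, 1 ≤ a ≤ b, gcd(a,b) = 1}`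
  [LaiYu2020, Def. 2.1] (`𝓕_B` rendered as the rationals `θ ∈ (0,1]` whose REDUCED denominator lies in `Ψ_B` —
  the same set, since `a/b` with `gcd(a,b) = 1`, `1 ≤ a ≤ b` is exactly a reduced fraction in `(0,1]` with
  denominator `b`); PROVED API: `Ψ_B` is finite and divisor-closed, and Proposition 2.2 (2)
  (`{1/b, 2/b, …, b/b} ⊂ 𝓕_B` for `b ∈ Ψ_B`);
* NAMED FACT `card_denominatorSet` — [LaiYu2020, Prop. 2.2 (1)]: `|Ψ_B| = (ζ(2)ζ(3)/ζ(6) + o(1)) B` (the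
  counting function of the values of Euler's `φ`; "we refer the readers to [Dr70] or [Ba72]" = R. E. Dressler,
  Pacific J. Math. 34 (1970) 371–378; P. T. Bateman, Acta Arith. 21 (1972) 329–345 [Bateman1972]);
* NAMED FACT `prop61` — [LaiYu2020, Prop. 6.1]: for `D` pairwise distinct positive integers `b₁, …, b_D`,
  `∏ bᵢ^{φ(bᵢ)} ≥ exp((½ ζ(6)/(ζ(2)ζ(3)) + o_{D→∞}(1)) D² log D)` (the optimality of `𝓕_B` among FSZ zero sets, §6);
* NAMED FACT `lai2025_theorem11` — [Lai2025, Thm 1.1].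

Rendering (as in the sibling files `FischlerSprangZudilin2019/ManyOddZetaValues.lean`,
`Fischler2026/OddZetaLinearIndependence.lean`): `ζ(k) = zetaValue k`
(`Literature.NumberTheory.Transcendental.zetaValue`, `= ∑' n, 1/n^k`); "sufficiently large (with respect to `ε`)"
as `∃ s₀, ∀ s ≥ s₀`; the count as the `Set.ncard` of the finite set of odd `i ∈ [3, s]` with `ζ(i)` irrational;
`s^{1/2}/log^{1/2} s` as `Real.sqrt s / Real.sqrt (Real.log s)`; `e = Real.exp 1`; an `o(1)` inside a one-sided
bound as "`∀ ε > 0`, eventually, the bound with `∓ ε`".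

NOT typed (deliberately): the FSZ-type auxiliary functions `Rₙ(t)` of [LaiYu2020, Def. 2.3] and the lemmas of
§§2–4 about them (construction-specific); [LaiYu2020, §6, last paragraph] "we claim that, by making out all the
implicit constants, we have a weaker but explicit result: For all odd integer `s ≥ 10⁴`, there are at least
`(1/10) s^{1/2}/(log s)^{1/2}` many irrational numbers among `ζ(3), …, ζ(s)`" — a CLAIM printed without proof,
hence not a Literature fact; [Lai2025, Thm 5.2] (the parametric version with `ϖ`, `r₀(M, δ)`, `C₀`).

Cell zeta5-irr / pub-zeta5 (HONEST FRAMING: systematic search; no irrationality claim unless certified): RECORD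
entries for the elimination lane (`fam-elim`); nothing here bears on `ζ(5)` itself ("So far, the irrationality
of `ζ(5)` remains open" [Lai2025, §1]).
-/

noncomputable section

open Filter
open scoped Topology

namespace Literature.NumberTheory.Irrationality.LaiYu2020

open Literature.NumberTheory.Transcendental (zetaValue)

/-! ### Lai–Yu 2020, Theorem 1.1 -/

/-- `r₀ = (√(4e² + 1) − 1)/2 ≈ 2.26388`, "the maximum point of the function
`r ↦ ((r+1) log(r+1) − r log r − 1)/(2r+1)`", "with maximal value `1 − log r₀`" — the limiting Ball–Rivoal
length parameter. [cite: LaiYu2020, §5 (before the proof of Theorem 1.1); §2 (first paragraph)] -/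
def r₀ : ℝ := (Real.sqrt (4 * Real.exp 1 ^ 2 + 1) - 1) / 2

/-- The constant `c₀ = √( (4ζ(2)ζ(3)/ζ(6)) · (1 − log((√(4e²+1) − 1)/2)) ) = 1.192507…` of Theorem 1.1
("The constant `c₀` in Theorem 1.1 is designed by `c₀ = √((4ζ(2)ζ(3)/ζ(6))(1 − log r₀))`").
[cite: LaiYu2020, Thm 1.1 (display) and §5] -/
def c₀ : ℝ := Real.sqrt (4 * zetaValue 2 * zetaValue 3 / zetaValue 6 * (1 - Real.log r₀))

/-- `c₀` unfolded to the printed closed form of Theorem 1.1. [cite: LaiYu2020, Thm 1.1] -/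
theorem c₀_def :
    c₀ = Real.sqrt (4 * zetaValue 2 * zetaValue 3 / zetaValue 6 *
      (1 - Real.log ((Real.sqrt (4 * Real.exp 1 ^ 2 + 1) - 1) / 2))) := rfl

/-- **Lai–Yu 2020, Theorem 1.1** (named fact, statement only): "For any small `ε > 0`, for all odd integer `s`
sufficiently large with respect to `ε`, there are at least `(c₀ − ε) s^{1/2}/log^{1/2} s` many irrational numbers
among `{ζ(3), ζ(5), ζ(7), ⋯, ζ(s)}`, where the constant
`c₀ = √((4ζ(2)ζ(3)/ζ(6))(1 − log((√(4e²+1) − 1)/2))) = 1.192507…`" — the count rendered as the cardinality of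
`{i odd, 3 ≤ i ≤ s, ζ(i) ∉ ℚ}` ("small" is vacuous: the statement weakens as `ε` grows).
[cite: LaiYu2020, Thm 1.1 (§1; arXiv:1911.08458 p. 2)] -/
def theorem11 : Prop :=
  ∀ ε : ℝ, 0 < ε → ∃ s₀ : ℕ, ∀ s : ℕ, s₀ ≤ s → Odd s →
    (c₀ - ε) * Real.sqrt s / Real.sqrt (Real.log s) ≤
      (({i : ℕ | Odd i ∧ 3 ≤ i ∧ i ≤ s ∧ Irrational (zetaValue i)}).ncard : ℝ)

/-! ### Lai–Yu 2020, §2: the denominator set `Ψ_B` and the zero set `𝓕_B` -/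

/-- The **denominator set** `Ψ_B = {b ∈ ℕ | φ(b) ≤ B}` (`ℕ` = the positive integers; `B` a positive real
number; `φ` Euler's totient). [cite: LaiYu2020, Def. 2.1 (1)] -/
def denominatorSet (B : ℝ) : Set ℕ := {b | 0 < b ∧ (Nat.totient b : ℝ) ≤ B}

/-- The **zero set** `𝓕_B = {a/b ∈ ℚ | b ∈ Ψ_B, 1 ≤ a ≤ b, gcd(a,b) = 1}`, i.e. the rationals `θ ∈ (0, 1]`
whose reduced denominator lies in `Ψ_B` ("the zeros in the interval `(0,1]` of our auxiliary rational
functions"). [cite: LaiYu2020, Def. 2.1 (2)] -/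
def zeroSet (B : ℝ) : Set ℚ := {θ | 0 < θ ∧ θ ≤ 1 ∧ θ.den ∈ denominatorSet B}

/-- Unfolding `b ∈ Ψ_B`. [cite: LaiYu2020, Def. 2.1 (1)] -/
theorem mem_denominatorSet {B : ℝ} {b : ℕ} : b ∈ denominatorSet B ↔ 0 < b ∧ (Nat.totient b : ℝ) ≤ B :=
  Iff.rfl

/-- Unfolding `θ ∈ 𝓕_B`. [cite: LaiYu2020, Def. 2.1 (2)] -/
theorem mem_zeroSet {B : ℝ} {θ : ℚ} : θ ∈ zeroSet B ↔ 0 < θ ∧ θ ≤ 1 ∧ θ.den ∈ denominatorSet B := Iff.rfl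

/-- `Ψ_B` is closed under divisors: "if `b ∈ Ψ_B` and `b'` is any divisor of `b`, then
`φ(b') ≤ φ(b) ≤ B`, so `b' ∈ Ψ_B`". [cite: LaiYu2020, proof of Prop. 2.2 (2)] -/
theorem mem_denominatorSet_of_dvd {B : ℝ} {b d : ℕ} (hb : b ∈ denominatorSet B) (hd : d ∣ b) :
    d ∈ denominatorSet B := by
  obtain ⟨hb0, hbB⟩ := hb
  have hd0 : 0 < d := Nat.pos_of_dvd_of_pos hd hb0
  refine ⟨hd0, le_trans ?_ hbB⟩
  exact_mod_cast Nat.le_of_dvd (Nat.totient_pos.2 hb0) (Nat.totient_dvd_of_dvd hd)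

/-- `Ψ_B` is a finite set (`φ(b) → ∞`; here from Hardy–Wright's Theorem 327 `φ(n)/n^{1/2} → ∞`, tree
`Multiplicative.SigmaTotientOrder`). [cite: LaiYu2020, Def. 2.1 and Prop. 2.2 (1)] -/
theorem denominatorSet_finite (B : ℝ) : (denominatorSet B).Finite := by
  have h := Literature.NumberTheory.Multiplicative.SigmaTotientOrder.tendsto_totient_div_rpow_atTop
    (δ := (1 / 2 : ℝ)) (by norm_num)
  have hpow : Tendsto (fun n : ℕ => (n : ℝ) ^ (1 - (1 / 2 : ℝ))) atTop atTop := by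
    have : Tendsto (fun x : ℝ => x ^ (1 - (1 / 2 : ℝ))) atTop atTop :=
      tendsto_rpow_atTop (by norm_num)
    exact this.comp tendsto_natCast_atTop_atTop
  have hφ : Tendsto (fun n : ℕ => (Nat.totient n : ℝ)) atTop atTop := by
    have hmul := h.atTop_mul_atTop₀ hpow
    refine hmul.congr' ?_
    filter_upwards [eventually_ge_atTop 1] with n hn
    have hn : (0 : ℝ) < (n : ℝ) ^ (1 - (1 / 2 : ℝ)) := by positivity
    field_simp
  obtain ⟨N, hN⟩ := (tendsto_atTop.1 hφ (B + 1)).exists_forall_of_atTop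
  refine (Set.finite_lt_nat N).subset fun b hb => ?_
  by_contra hbN
  have := hN b (not_lt.1 hbN)
  have := hb.2
  linarith

/-- **Lai–Yu 2020, Proposition 2.2 (2)** (PROVED): for `b ∈ Ψ_B` and `k ∈ {1, 2, …, b}`, `k/b ∈ 𝓕_B` ("for any
`k ∈ {1, 2, ⋯, b}`, we have `k/b = (k/gcd(k,b))/(b/gcd(k,b)) ∈ 𝓕_B`"). [cite: LaiYu2020, Prop. 2.2 (2)] -/
theorem div_mem_zeroSet {B : ℝ} {b k : ℕ} (hb : b ∈ denominatorSet B) (hk1 : 1 ≤ k) (hkb : k ≤ b) :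
    ((k : ℚ) / b) ∈ zeroSet B := by
  have hb0 : 0 < b := hb.1
  have hbq : (0 : ℚ) < b := by exact_mod_cast hb0
  have hkq : (0 : ℚ) < k := by exact_mod_cast hk1
  refine ⟨div_pos hkq hbq, ?_, ?_⟩
  · rw [div_le_one hbq]; exact_mod_cast hkb
  · apply mem_denominatorSet_of_dvd hb
    have h := Rat.den_dvd (k : ℤ) (b : ℤ)
    rw [Rat.divInt_eq_div] at h
    push_cast at h
    exact_mod_cast h

/-- **Lai–Yu 2020, Proposition 2.2 (1)** (named fact, statement only): "The size of the set `Ψ_B` is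
`|Ψ_B| = (ζ(2)ζ(3)/ζ(6) + o_{B→+∞}(1)) B`" — the asymptotic count of the positive integers `b` with
`φ(b) ≤ B` ("known in the topic about inverse totient problem"; "For the first proposition, we refer the readers
to [Dr70] or [Ba72]": Dressler 1970, Bateman 1972 [Bateman1972]). Rendered: `|Ψ_B|/B → ζ(2)ζ(3)/ζ(6)` as the real
parameter `B → +∞`. [cite: LaiYu2020, Prop. 2.2 (1) (§2)] -/
def card_denominatorSet : Prop :=
  Tendsto (fun B : ℝ => ((denominatorSet B).ncard : ℝ) / B) atTop
    (𝓝 (zetaValue 2 * zetaValue 3 / zetaValue 6))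

/-! ### Lai–Yu 2020, §6: the arithmetic price of eliminating `D − 1` odd zeta values -/

/-- **Lai–Yu 2020, Proposition 6.1** (named fact, statement only): "If `b₁, b₂, ⋯, b_D` are `D` pairwise
distinct positive integers, then `∏_{i=1}^{D} bᵢ^{φ(bᵢ)} ≥ exp((½ · ζ(6)/(ζ(2)ζ(3)) + o_{D→+∞}(1)) D² log D)`."
Rendered with the `o(1)` (uniform in the `bᵢ`, as in the printed proof via the `D` smallest integers in the
`φ`-order) as: for every `ε > 0` and all sufficiently large `D`, every injective `b : Fin D → ℕ` with positive
values satisfies `exp((½ ζ(6)/(ζ(2)ζ(3)) − ε) D² log D) ≤ ∏ᵢ bᵢ^{φ(bᵢ)}`.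
[cite: LaiYu2020, Prop. 6.1 (§6 "Remarks on FSZ constructions")] -/
def prop61 : Prop :=
  ∀ ε : ℝ, 0 < ε → ∃ D₀ : ℕ, ∀ D : ℕ, D₀ ≤ D → ∀ b : Fin D → ℕ, Function.Injective b → (∀ i, 0 < b i) →
    Real.exp ((1 / 2 * (zetaValue 6 / (zetaValue 2 * zetaValue 3)) - ε) * (D : ℝ) ^ 2 * Real.log D) ≤
      ∏ i, ((b i : ℝ)) ^ (Nat.totient (b i))

/-! ### Lai 2025 (part II), Theorem 1.1: the record constant -/

/-- **Lai 2025, Theorem 1.1** (named fact, statement only): "For any sufficiently large positive integer `s`,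
we have `#{odd i ∈ [3, s] | ζ(i) ∉ ℚ} ≥ 1.284579 · √(s / log s)`." (Proof, §6: Theorem 5.2 there with
`M = 563`, `J = 76` and the tabulated `δ₁, …, δ₇₆` gives `C₀ = 1.284579…`; with `M = 1, J = 1, δ₁ = 0` it
"rediscover[s] the result in [LY2020]", `C₀ = 1.192507…`.) Here `s` ranges over ALL large integers (odd or
even), as printed. [cite: Lai2025, Thm 1.1 (§1; arXiv:2501.05321 p. 1) and §6 (proof)] -/
def lai2025_theorem11 : Prop :=
  ∃ s₀ : ℕ, ∀ s : ℕ, s₀ ≤ s →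
    (1.284579 : ℝ) * Real.sqrt (s / Real.log s) ≤
      (({i : ℕ | Odd i ∧ 3 ≤ i ∧ i ≤ s ∧ Irrational (zetaValue i)}).ncard : ℝ)

end Literature.NumberTheory.Irrationality.LaiYu2020
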